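import Summits.CriticalPhenomena.PercolationContinuityZ3.Theorems.Transplant.SkelNegBParamsReachEx
import HarnessLib

/-!
# N1 params, chain of record `NegB`, part Residuals2: THE RESIDUALS OF RECORD, SECOND VERSION — the box residual **`KS.gxR2 := 64·(n_b + ℓ_b + |h_b|)`** (kit index
# `0`; gives `64S ≤ M_L`, hence the sharp origin size **`4|Λ₀(yX)| ≤ 7m`** the y′-leg's transverse budget needs: `Λ₀_sdt_sharp`), and the `L′/E₀` residual
# **`NegB.exR2 := exR + (Yb + 11055·n_L + 1000·ℓ_L + 20)`** (adds the y′-leg's reach floor `hπ3`), with every earlier floor re-served (`floors_exR2`, `hex_exR2`)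

The node-level choice function of record becomes `negChoiceAllOT (KS.gT 0 KS.gxR2) (KS.fT 0 KS.fxR) (KS.PR 0 Px) (NegB.SU NegB.exR2 NegB.mxR)`.

builds on p205010 (kernel theorem, internal audit signed; external expert review pending) — nothing in this file uses p205010; NOTHING is claimed about
the node `SamePDropOfSkeletonNeg₁` (OPEN).
Lane `prim-bschramm-*`, seat `prim-bschramm-stmt` (gen 14); helper file (`--supports stmt-CriticalPhenomena-4575 --as helper`); ledger HOME/prim-bschramm-stmt/NEG-PARAMS.md v0.13.
[cite: KozmaNitzan2024, §4 Theorem 6 (pp. 25–31): the order of constants]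
-/

noncomputable section

open scoped Classical

namespace Summit.CriticalPhenomena.PercolationContinuityZ3.Theorems.Transplant

namespace PlanarSkeletonNeg

namespace NegB

open Literature.Probability.Percolation Literature.Probability.LatticeModels SimpleGraph
open SkelConc (Consts)
open Skelφ (shearUnit)
open Skelφ.StepI (DataN)
open TwoAxis.Para (modulus)
open Neg

/-! ## §1 The box residual `gxR2` and the sharp origin size -/

namespace KS

/-- **THE BOX RESIDUAL OF RECORD (second version)** `gxR2 := 64·(n_b + ℓ_b + |h_b|)` at kit index `0`. [this work] -/
def gxR2 : Neg.FSlot := fun κ _ _ _ _ _ Φ t p D => 64 * (nBR κ Φ t p D 0 + ℓBR κ Φ t p D 0 + (hBR κ Φ t p D 0).natAbs)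

section Sharp

variable (κ : Consts) {V : Type} [DecidableEq V] [Countable V] {G : SimpleGraph V} [G.LocallyFinite] (Φ : PlanarSkeletonNeg G) (t : V)
  (p : unitInterval) (D : DataN V) (mk : ℕ) (gx : Neg.FSlot) (f : ℕ)

/-- `64·(n_b + ℓ_b + |h_b|) ≤ M_L` at `g := gT 0 gxR2` (`gx ≤ gT`, `gT ≤ M_L`). [folklore] -/
theorem gxR2_floor : 64 * (nBR κ Φ t p D 0 + ℓBR κ Φ t p D 0 + (hBR κ Φ t p D 0).natAbs) ≤ ML κ Φ t p D (gT 0 gxR2 κ Φ t p D) :=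
  (ML_floorsT κ Φ t p D 0 gxR2).2.2.2.1

/-- **`4·|Λ₀(yLof)| ≤ 7m`** under the sharper floor `64S ≤ M_L` (displacements `≤ S`, midpoint `2mh ≤ ℓ_L + S`). [folklore] -/
theorem abs_Λ₀of_yLof_sharp (hN : EqNumL κ Φ t p D (gT mk gx κ Φ t p D) f) (hκ : (hL κ Φ t p D (gT mk gx κ Φ t p D) f).natAbs ≤ 10 * nL κ Φ t p D (gT mk gx κ Φ t p D) f)
    (hS64 : 64 * (nBR κ Φ t p D mk + ℓBR κ Φ t p D mk + (hBR κ Φ t p D mk).natAbs) ≤ ML κ Φ t p D (gT mk gx κ Φ t p D))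
    {σ : ℤ} (hσ : σ = 1 ∨ σ = -1) {d₀ d₁ mh : ℤ} (hd₀ : |d₀| ≤ ((nBR κ Φ t p D mk + ℓBR κ Φ t p D mk + (hBR κ Φ t p D mk).natAbs : ℕ) : ℤ)) (hd₁ : |d₁| ≤ ((nBR κ Φ t p D mk + ℓBR κ Φ t p D mk + (hBR κ Φ t p D mk).natAbs : ℕ) : ℤ)) (hmh : 0 ≤ mh) (hmh' : 2 * mh ≤ (ℓL κ Φ t p D (gT mk gx κ Φ t p D) f : ℤ) + ((nBR κ Φ t p D mk + ℓBR κ Φ t p D mk + (hBR κ Φ t p D mk).natAbs : ℕ) : ℤ)) :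
    4 * |Λ₀of κ Φ t p D (gT mk gx κ Φ t p D) f (yLof κ Φ t p D (gT mk gx κ Φ t p D) f σ d₀ d₁ mh)| ≤ 7 * modulus (nL κ Φ t p D (gT mk gx κ Φ t p D) f) (hL κ Φ t p D (gT mk gx κ Φ t p D) f) (vL κ Φ t p D (gT mk gx κ Φ t p D) f) (Skelφ.NegPrm.vβOf (nL κ Φ t p D (gT mk gx κ Φ t p D) f) (hL κ Φ t p D (gT mk gx κ Φ t p D) f) (ℓL κ Φ t p D (gT mk gx κ Φ t p D) f) (vL κ Φ t p D (gT mk gx κ Φ t p D) f)) := by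
  obtain ⟨hn1, hℓ1⟩ := one_le_of_eqNumL κ Φ t p D _ f hN
  have hvβ := abs_vβL_le κ Φ t p D _ f hN hκ
  have hv : |vL κ Φ t p D (gT mk gx κ Φ t p D) f| ≤ nL κ Φ t p D (gT mk gx κ Φ t p D) f := hN.v_le
  have hMn := hN.n_le
  have hMℓ := hN.ℓ_le
  have hm := (Skelφ.NegPrm.modulus_vβOf hn1 (hL κ Φ t p D (gT mk gx κ Φ t p D) f) (ℓL κ Φ t p D (gT mk gx κ Φ t p D) f) (vL κ Φ t p D (gT mk gx κ Φ t p D) f)).1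
  have hκ' : |hL κ Φ t p D (gT mk gx κ Φ t p D) f| ≤ 10 * (nL κ Φ t p D (gT mk gx κ Φ t p D) f : ℤ) := by rw [← Int.natCast_natAbs]; exact_mod_cast hκ
  have hS64' : 64 * ((nBR κ Φ t p D mk + ℓBR κ Φ t p D mk + (hBR κ Φ t p D mk).natAbs : ℕ) : ℤ) ≤ (ML κ Φ t p D (gT mk gx κ Φ t p D) : ℤ) := by
    have h' : ((64 * (nBR κ Φ t p D mk + ℓBR κ Φ t p D mk + (hBR κ Φ t p D mk).natAbs) : ℕ) : ℤ) ≤ (ML κ Φ t p D (gT mk gx κ Φ t p D) : ℤ) := by exact_mod_cast hS64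
    simpa only [Nat.cast_mul, Nat.cast_ofNat] using h'
  have h22 : 22000 * ((RA' κ Φ t p D mk : ℤ) + 2) ≤ (ML κ Φ t p D (gT mk gx κ Φ t p D) : ℤ) := by
    have h' : ((22000 * (RA' κ Φ t p D mk + 2) : ℕ) : ℤ) ≤ (ML κ Φ t p D (gT mk gx κ Φ t p D) : ℤ) := by exact_mod_cast (ML_floorsT κ Φ t p D mk gx).2.1
    push_cast at h'; exact h'
  have hσ' : |σ| = 1 := by rcases hσ with h | h <;> simp [h]
  rw [Λ₀of_yLof]
  have e : vβL κ Φ t p D (gT mk gx κ Φ t p D) f = Skelφ.NegPrm.vβOf (nL κ Φ t p D (gT mk gx κ Φ t p D) f) (hL κ Φ t p D (gT mk gx κ Φ t p D) f) (ℓL κ Φ t p D (gT mk gx κ Φ t p D) f) (vL κ Φ t p D (gT mk gx κ Φ t p D) f) := rfl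
  rw [← e] at hm ⊢
  generalize modulus (nL κ Φ t p D (gT mk gx κ Φ t p D) f) (hL κ Φ t p D (gT mk gx κ Φ t p D) f) (vL κ Φ t p D (gT mk gx κ Φ t p D) f) (vβL κ Φ t p D (gT mk gx κ Φ t p D) f) = m at hm ⊢
  generalize ((nBR κ Φ t p D mk + ℓBR κ Φ t p D mk + (hBR κ Φ t p D mk).natAbs : ℕ) : ℤ) = S at hd₀ hd₁ hmh' hS64'
  generalize (nL κ Φ t p D (gT mk gx κ Φ t p D) f : ℤ) = n at hn1 hvβ hv hMn hm hκ' ⊢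
  generalize (ℓL κ Φ t p D (gT mk gx κ Φ t p D) f : ℤ) = ℓ at hℓ1 hvβ hMℓ hm hmh' ⊢
  generalize (ML κ Φ t p D (gT mk gx κ Φ t p D) : ℤ) = M at hMn hMℓ hS64' h22
  generalize vβL κ Φ t p D (gT mk gx κ Φ t p D) f = vβ at hvβ ⊢
  generalize vL κ Φ t p D (gT mk gx κ Φ t p D) f = vα at hv ⊢
  generalize hL κ Φ t p D (gT mk gx κ Φ t p D) f = hh at hκ' ⊢
  have hR0 : (0 : ℤ) ≤ (RA' κ Φ t p D mk : ℤ) := by positivity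
  have hS0 : 0 ≤ S := le_trans (abs_nonneg _) hd₀
  have hn0 : (0 : ℤ) ≤ n := by linarith
  have hm0 : 0 < m := by nlinarith
  have hm4 : 40000 * n ≤ m := by
    have := mul_le_mul_of_nonneg_left (show (43999:ℤ) ≤ ℓ - 1 by linarith) hn0
    linarith
  have p1 : |vβ * d₀| ≤ (ℓ + 10 * n + 1) * S := by rw [abs_mul]; exact mul_le_mul hvβ hd₀ (abs_nonneg _) (by linarith [abs_nonneg vβ])
  have p2 : |vα * d₁| ≤ n * S := by rw [abs_mul]; exact mul_le_mul hv hd₁ (abs_nonneg _) hn0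
  have p3 : |vα * mh| ≤ n * mh := by rw [abs_mul, abs_of_nonneg hmh]; exact mul_le_mul_of_nonneg_right hv hmh
  have q1 : (ℓ + 1) * (64 * S) ≤ (ℓ + 1) * (n - 1) := mul_le_mul_of_nonneg_left (by linarith) (by linarith)
  have q2 : n * (64 * S) ≤ n * (ℓ - 1) := mul_le_mul_of_nonneg_left (by linarith) hn0
  have q3 : n * (2 * mh) ≤ n * (ℓ + S) := mul_le_mul_of_nonneg_left hmh' hn0
  have a1 : |σ * m| = m := by rw [abs_mul, hσ', one_mul, abs_of_pos hm0]
  have a2 : |σ * (vβ * d₀ - vα * d₁)| ≤ (ℓ + 10 * n + 1) * S + n * S := by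
    rw [abs_mul, hσ', one_mul]; exact (abs_sub _ _).trans (add_le_add p1 p2)
  have key : |σ * m + σ * (vβ * d₀ - vα * d₁) - vα * mh| ≤ m + ((ℓ + 10 * n + 1) * S + n * S) + n * mh :=
    calc |σ * m + σ * (vβ * d₀ - vα * d₁) - vα * mh| ≤ |σ * m + σ * (vβ * d₀ - vα * d₁)| + |vα * mh| := abs_sub _ _
      _ ≤ |σ * m| + |σ * (vβ * d₀ - vα * d₁)| + |vα * mh| := by linarith [abs_add_le (σ * m) (σ * (vβ * d₀ - vα * d₁))]
      _ ≤ m + ((ℓ + 10 * n + 1) * S + n * S) + n * mh := by rw [a1]; linarith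
  nlinarith

/-- **The three origins' sharp sizes** at `64S ≤ M_L`: `4|Λ₀(yLs)| ≤ 7m`, same for `yLd`, `yLt` (needs `27 ≤ ℓ_b`). [folklore] -/
theorem Λ₀_sdt_sharp (hN : EqNumL κ Φ t p D (gT mk gx κ Φ t p D) f) (hκ : (hL κ Φ t p D (gT mk gx κ Φ t p D) f).natAbs ≤ 10 * nL κ Φ t p D (gT mk gx κ Φ t p D) f)
    (hS64 : 64 * (nBR κ Φ t p D mk + ℓBR κ Φ t p D mk + (hBR κ Φ t p D mk).natAbs) ≤ ML κ Φ t p D (gT mk gx κ Φ t p D)) {σ : ℤ} (hσ : σ = 1 ∨ σ = -1)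
    (hℓb : 27 ≤ ℓBR κ Φ t p D mk) :
    4 * |Λ₀of κ Φ t p D (gT mk gx κ Φ t p D) f (yLs κ Φ t p D (gT mk gx κ Φ t p D) f mk σ)| ≤ 7 * modulus (nL κ Φ t p D (gT mk gx κ Φ t p D) f) (hL κ Φ t p D (gT mk gx κ Φ t p D) f) (vL κ Φ t p D (gT mk gx κ Φ t p D) f) (Skelφ.NegPrm.vβOf (nL κ Φ t p D (gT mk gx κ Φ t p D) f) (hL κ Φ t p D (gT mk gx κ Φ t p D) f) (ℓL κ Φ t p D (gT mk gx κ Φ t p D) f) (vL κ Φ t p D (gT mk gx κ Φ t p D) f)) ∧ 4 * |Λ₀of κ Φ t p D (gT mk gx κ Φ t p D) f (yLd κ Φ t p D (gT mk gx κ Φ t p D) f mk σ)| ≤ 7 * modulus (nL κ Φ t p D (gT mk gx κ Φ t p D) f) (hL κ Φ t p D (gT mk gx κ Φ t p D) f) (vL κ Φ t p D (gT mk gx κ Φ t p D) f) (Skelφ.NegPrm.vβOf (nL κ Φ t p D (gT mk gx κ Φ t p D) f) (hL κ Φ t p D (gT mk gx κ Φ t p D) f) (ℓL κ Φ t p D (gT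 mk gx κ Φ t p D) f) (vL κ Φ t p D (gT mk gx κ Φ t p D) f)) ∧
      4 * |Λ₀of κ Φ t p D (gT mk gx κ Φ t p D) f (yLt κ Φ t p D (gT mk gx κ Φ t p D) f mk σ)| ≤ 7 * modulus (nL κ Φ t p D (gT mk gx κ Φ t p D) f) (hL κ Φ t p D (gT mk gx κ Φ t p D) f) (vL κ Φ t p D (gT mk gx κ Φ t p D) f) (Skelφ.NegPrm.vβOf (nL κ Φ t p D (gT mk gx κ Φ t p D) f) (hL κ Φ t p D (gT mk gx κ Φ t p D) f) (ℓL κ Φ t p D (gT mk gx κ Φ t p D) f) (vL κ Φ t p D (gT mk gx κ Φ t p D) f)) := by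
  have hS : (0 : ℤ) ≤ ((nBR κ Φ t p D mk + ℓBR κ Φ t p D mk + (hBR κ Φ t p D mk).natAbs : ℕ) : ℤ) := by positivity
  have eS : ((nBR κ Φ t p D mk + ℓBR κ Φ t p D mk + (hBR κ Φ t p D mk).natAbs : ℕ) : ℤ) = (nBR κ Φ t p D mk : ℤ) + ℓBR κ Φ t p D mk + |hBR κ Φ t p D mk| := by push_cast [Int.natCast_natAbs]; ring
  have hℓb' : (27 : ℤ) ≤ ℓBR κ Φ t p D mk := by exact_mod_cast hℓb
  obtain ⟨l1, l2⟩ := RootArith.floor_sandwich (x := (ℓL κ Φ t p D (gT mk gx κ Φ t p D) f : ℤ)) (d := 2) (by norm_num)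
  refine ⟨?_, ?_, ?_⟩
  · obtain ⟨m1, m2⟩ := RootArith.floor_sandwich (x := (ℓL κ Φ t p D (gT mk gx κ Φ t p D) f : ℤ) + ℓBR κ Φ t p D mk) (d := 2) (by norm_num)
    refine abs_Λ₀of_yLof_sharp κ Φ t p D mk gx f hN hκ hS64 hσ ?_ ?_ ?_ ?_
    · rw [eS, Nat.abs_cast]; linarith [abs_nonneg (hBR κ Φ t p D mk)]
    · rw [eS]; linarith
    · show (0 : ℤ) ≤ mhs κ Φ t p D (gT mk gx κ Φ t p D) f mk; unfold mhs; omega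
    · show 2 * mhs κ Φ t p D (gT mk gx κ Φ t p D) f mk ≤ _; unfold mhs; rw [eS]; linarith [abs_nonneg (hBR κ Φ t p D mk)]
  · obtain ⟨d1, d2⟩ := RootArith.floor_sandwich (x := 2 * |hBR κ Φ t p D mk| + (ℓBR κ Φ t p D mk : ℤ)) (d := 2) (by norm_num)
    have hs : |Skelφ.sgnz (hBR κ Φ t p D mk)| = 1 := by rcases Skelφ.sgnz_cases (hBR κ Φ t p D mk) with h | h <;> simp [h]
    refine abs_Λ₀of_yLof_sharp κ Φ t p D mk gx f hN hκ hS64 hσ ?_ ?_ ?_ ?_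
    · show |d0d κ Φ t p D mk| ≤ _
      unfold d0d; rw [eS, abs_le]; constructor <;> linarith [abs_nonneg (hBR κ Φ t p D mk)]
    · rw [abs_mul, hs, one_mul, Nat.abs_cast, eS]; linarith [abs_nonneg (hBR κ Φ t p D mk)]
    · omega
    · linarith
  · refine abs_Λ₀of_yLof_sharp κ Φ t p D mk gx f hN hκ hS64 hσ ?_ ?_ ?_ ?_
    · rw [eS, abs_le]; constructor <;> linarith [abs_nonneg (hBR κ Φ t p D mk)]
    · simp only [abs_zero]; exact hS
    · omega
    · linarith

end Sharp

end KS

/-! ## §2 The `L′/E₀` residual, second version -/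

section Ex

variable (κ : Consts) {V : Type} [DecidableEq V] [Countable V] {G : SimpleGraph V} [G.LocallyFinite] (Φ : PlanarSkeletonNeg G) (t : V)
  (p : unitInterval) (D : DataN V) (g f : ℕ)

/-- **THE `L′/E₀` RESIDUAL OF RECORD (second version)** `exR2 := exR + (Yb + 11055·n_L + 1000·ℓ_L + 20)` (the y′-leg's reach `hπ3`). [this work] -/
def exR2 : GSlot := fun κ _ _ _ _ _ Φ t p D g f => exR κ Φ t p D g f + (Yb κ Φ t p D g f + 11055 * nL κ Φ t p D g f + 1000 * ℓL κ Φ t p D g f + 20)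

/-- `exR ≤ exR2` and the y′-reach floor `Yb + 11055 n_L + 1000 ℓ_L + 20 ≤ exR2`. [folklore] -/
theorem exR_le_exR2 : exR κ Φ t p D g f ≤ exR2 κ Φ t p D g f ∧ Yb κ Φ t p D g f + 11055 * nL κ Φ t p D g f + 1000 * ℓL κ Φ t p D g f + 20 ≤ exR2 κ Φ t p D g f := by
  unfold exR2; omega

/-- Every `exR`-floor at `exR2`. [folklore] -/
theorem floors_exR2 :
    KS.r₀A Φ t D 0 (Rb κ Φ t p D) + 1 ≤ exR2 κ Φ t p D g f ∧ KS.r₀A Φ t D 0 (Rl κ Φ t p D g f) + 1 ≤ exR2 κ Φ t p D g f ∧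
    Rl κ Φ t p D g f + 1 ≤ exR2 κ Φ t p D g f ∧ Rb κ Φ t p D + 1 ≤ exR2 κ Φ t p D g f ∧
    Yb κ Φ t p D g f + 1000 * shearUnit (nL κ Φ t p D g f) (hL κ Φ t p D g f) + 1 ≤ exR2 κ Φ t p D g f ∧
    exC κ Φ t p D g f ≤ exR2 κ Φ t p D g f ∧ KS.RlevA κ Φ t p D 0 + KS.reachA t D 0 ≤ exR2 κ Φ t p D g f ∧
    KS.r₀A Φ t D 0 (Rl κ Φ t p D g f) ≤ exR2 κ Φ t p D g f := by
  have h := floors_exR κ Φ t p D g f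
  have h2 := (exR_le_exR2 κ Φ t p D g f).1
  omega

/-- **p5-g9's `hex` at `ex := exR2`** (any `g, f`). [folklore] -/
theorem hex_exR2_at : KS.r₀A Φ t D 0 (D.R (D.scale t (ML κ Φ t p D g) (nL κ Φ t p D g f))) + 3 ≤ exR2 κ Φ t p D g f ∧
      4 + 13 * (800 * (nL κ Φ t p D g f + Skelφ.CorrRec.Qw (nL κ Φ t p D g f) (ℓL κ Φ t p D g f) (hL κ Φ t p D g f))) ≤ exR2 κ Φ t p D g f := by
  have h := hex_exR_at κ Φ t p D g f
  have h2 := (exR_le_exR2 κ Φ t p D g f).1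
  omega

end Ex

/-- **p5-g9's `hex` at `ex := exR2`, kit index `0`, any box/width residuals** (the binder shape of `reachHoldsRHNOFn_negChoiceAllOT`). [folklore] -/
theorem hex_exR2 (gx fx : Neg.FSlot) :
    ∀ (κ : Consts) {V : Type} [DecidableEq V] [Countable V] {G : SimpleGraph V} [G.LocallyFinite] (Φ : PlanarSkeletonNeg G) (t : V) (p : unitInterval) (D : DataN V),
      KS.r₀A Φ t D 0 (D.R (D.scale t (ML κ Φ t p D (KS.gT 0 gx κ Φ t p D)) (nL κ Φ t p D (KS.gT 0 gx κ Φ t p D) (KS.fT 0 fx κ Φ t p D)))) + 3 ≤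
          exR2 κ Φ t p D (KS.gT 0 gx κ Φ t p D) (KS.fT 0 fx κ Φ t p D) ∧
        4 + 13 * (800 * (nL κ Φ t p D (KS.gT 0 gx κ Φ t p D) (KS.fT 0 fx κ Φ t p D) +
          Skelφ.CorrRec.Qw (nL κ Φ t p D (KS.gT 0 gx κ Φ t p D) (KS.fT 0 fx κ Φ t p D)) (ℓL κ Φ t p D (KS.gT 0 gx κ Φ t p D) (KS.fT 0 fx κ Φ t p D))
            (hL κ Φ t p D (KS.gT 0 gx κ Φ t p D) (KS.fT 0 fx κ Φ t p D)))) ≤ exR2 κ Φ t p D (KS.gT 0 gx κ Φ t p D) (KS.fT 0 fx κ Φ t p D) :=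
  fun κ _ _ _ _ _ Φ t p D => hex_exR2_at κ Φ t p D _ _

end NegB

end PlanarSkeletonNeg

end Summit.CriticalPhenomena.PercolationContinuityZ3.Theorems.Transplant
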